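import Literature.RingTheory.ZeroDimensional.SeparatingForm
import Literature.RingTheory.ZeroDimensional.RationalShapeLemma
import Literature.RingTheory.ZeroDimensional.IntegralShapeLemma
import Literature.RingTheory.ZeroDimensional.IntegralShapeLemmaBounds
import Literature.Computability.AlgebraicComplexity.BurgisserReductionModPrimesProofs
import Literature.Computability.AlgebraicComplexity.ValiantBooleanBridgeBurgisserProofs
import Mathlib.Analysis.Polynomial.CauchyBound
import Mathlib.Analysis.Complex.ExponentialBounds
import HarnessLib

/-!
# Bürgisser's ingredient (B) of Theorem 4.5 — Krick–Pardo's shape lemma with heights — from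
# zero-dimensional Bézout and the heights of the points

Topic `Literature/Computability/AlgebraicComplexity`; companion of
`BurgisserReductionModPrimesProofs.lean`. Bürgisser, *Cook's versus Valiant's hypothesis*,
TCS 235 (2000), Thm. 4.5 (the named fact `algebraicSolution_height_bound`) is proved in the tree
from two hypotheses stated exactly as the printed proof consumes them
(`algebraicSolution_height_bound_of_ingredients (hA) (hB)`): (A) Lemmas 4.3–4.4, and (B) the
paragraph of p. 82 invoking Krick–Pardo [18, Prop. 27] and Lemma 2.4:

> "the existence of an integer linear form `ℓ`, of a positive integer `λ`, and of univariate
> integer polynomials `v_i ∈ ℤ[Y]` such that (1) the linear form `ℓ` separates the points of `V`,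
> (2) we have `x_i = λ⁻¹ v_i(ℓ(x))` for all `x ∈ V`, (3) `wt(ℓ) = d^{O(n)}`, (4) both `λ` and the
> coefficients of the `v_i` … can be evaluated … by a division-free straight-line program of size
> `d^{O(n)}` and multiplicative depth `O(n log d)` … we conclude with Lemma 2.4 that
> `deg v_i = d^{O(n)}`, `max{log λ, log wt(v_i)} = d^{O(n)} log w`."

This file PROVES (B) from two classical statements about the POINTS of the finite variety
`V = Z(F_1, …, F_n)`, taken as explicit hypotheses (they are theorems of algebraic resp.
arithmetic geometry not yet in the tree; D-0026: no named fact is introduced here):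

* `hBez` — **zero-dimensional Bézout**: `|V| ≤ dⁿ` for `n` integer polynomials of degree `≤ d` in
  `n` variables with finite complex zero set (Bézout's inequality, [7, Thm. 8.28] in the paper =
  Bürgisser–Clausen–Shokrollahi; Heintz 1983);
* `hHt` — **heights of the points**: every coordinate of every point of `V` is a root of a nonzero
  integer polynomial `P` with `log wt(P) ≤ c₀ d^{c₀ n} log W` (the arithmetic Bézout inequality for
  the isolated points, e.g. Krick–Pardo–Sombra, Duke Math. J. 109 (2001); in [18] it is part of
  the height analysis of the straight-line programs of Prop. 27 (4)).

From these, items (1)–(2) and the bounds of (B) follow by elementary algebra, proved in the tree's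
zero-dimensional files: a separating form with coefficients `≤ N²` scaled by the common denominator
`c = ∏ |lc(P)|` of the points (`Literature/RingTheory/ZeroDimensional/SeparatingForm.lean`), the
rational shape lemma (`RationalShapeLemma.lean`: `ℚ[ℓ] =` the coordinate ring of `V`, by counting
the geometric points of a finite reduced `ℚ`-algebra), the integrality of the minimal polynomial
`μ` of `ℓ`, the integer `D = Res(μ, μ') = ∏_z μ'(ℓ(z)) ≠ 0` and the integer Lagrange–Euler
interpolants `W_i = ∑_z (c z_i)(∏_{z'≠z} μ'(ℓ z')) ∏_{z'≠z}(T - ℓ z')` with `c D z_i = W_i(ℓ(z))`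
(`IntegralShapeLemma.lean`; so `λ = c |D|`, `v_i = sign(D) W_i`), and their archimedean sizes
(`IntegralShapeLemmaBounds.lean`: triangle inequality only — a rational algebraic integer is an
integer, and its size is its complex absolute value, so no Galois conjugates enter). Cauchy's root
bound gives `|z_i| ≤ wt(P) + 1`, and the bookkeeping `shape_log_bookkeeping` converts
`λ, wt(v_i) ≤ (N+1)² B^{Nn+1} (2Y)^{N²}` (`B = W^{c₀ d^{c₀ n}} + 1`, `Y = n N² B^{Nn+1} + 1`,
`N ≤ dⁿ`) into `c d^{c n} log W` with `c = 48 (c₀ + 4)`.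

## Main results (namespace `Literature.Computability.AlgebraicComplexity`, everything proved)

* `exists_integer_shape_of_pointData` — the integer geometric resolution of a finite
  `ℚ`-subvariety of `ℂⁿ` from denominators and sizes of its points, with raw bounds;
* `shape_log_bookkeeping` — the logarithmic bookkeeping;
* `norm_le_polyWeight_add_one_of_aeval_eq_zero` — Cauchy's bound `|z| ≤ wt(P) + 1`;
* `krickPardo_shape_of_bezout_of_pointHeights` — **(B) from `hBez` and `hHt`**, in the exact form of
  the hypothesis `hB` of `algebraicSolution_height_bound_of_ingredients`;
* `algebraicSolution_height_bound_of_zeroDimReduction_of_bezout_of_pointHeights` — Thm. 4.5 from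
  (A), `hBez`, `hHt`;
* `PPoly_eq_polyAdvice_NP_of_VP_eq_VNP_of_zeroDimReduction_of_bezout_of_pointHeights` — hence the
  target fact `PPoly_eq_polyAdvice_NP_of_VP_eq_VNP k` (TCS Cor. 1.2(1)) from the same three
  statements, everything else (GRH prime ideal theorem, Cor. 4.8, Thm. 4.1, (A2), (A3)) being
  proved in the tree.

What is NOT here: proofs of (A), of zero-dimensional Bézout and of the point-height bound (degree
theory of affine varieties / arithmetic Bézout), and the straight-line-program formulation of
[18, Prop. 27 (4)] (replaced by the direct interpolation argument above).

## References

* P. Bürgisser, *Cook's versus Valiant's hypothesis*, TCS 235 (2000) 71–88, Thm. 4.5 and its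
  proof, p. 82; Lemma 2.4. [Burgisser2000TCS]
* T. Krick, L. M. Pardo, *A computational method for Diophantine approximation*, Progr. Math. 143
  (1996) 193–253, Prop. 27. [KrickPardo1996]
* T. Krick, L. M. Pardo, M. Sombra, *Sharp estimates for the arithmetic Nullstellensatz*, Duke
  Math. J. 109 (2001) 521–598 (heights of zero-dimensional varieties).
-/

noncomputable section

open scoped Classical
open Polynomial Lagrange Finset Literature.RingTheory.ZeroDimensional

namespace Literature.Computability.AlgebraicComplexity

/-! ### Stage A: the integer geometric resolution with raw bounds -/

/-- **Integer geometric resolution of a finite `ℚ`-variety from denominators and sizes of its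
points.** Let `V ⊆ ℂⁿ` be a finite set cut out by rational polynomials, and suppose every
coordinate `z_i` of every `z ∈ V` satisfies `|z_i| ≤ B` and `b_{z,i} z_i` is an algebraic integer
for some `0 < b_{z,i} ≤ B` (`B ≥ 2`). Then there are an integer linear form `ℓ`, a positive
integer `λ` and `v_i ∈ ℤ[T]` of degree `< N = |V|` with `z_i = λ⁻¹ v_i(ℓ(z))` on `V`,
`λ ≤ B^{Nn} (2Y)^{N²}` and `wt(v_i) ≤ N² B^{Nn+1} (2Y)^{N²}`, `Y = n N² B^{Nn+1} + 1`
(Krick–Pardo 1996, Prop. 27 (1)–(2) with explicit heights, as used by Bürgisser 2000 TCS p. 82;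
here via `c = ∏ b_{z,i}`, a separating form with coefficients `≤ N²` times `c`, the rational
and integral shape lemmas and the bounds of `Literature/RingTheory/ZeroDimensional`).
[cite: KrickPardo1996, Prop. 27] -/
theorem exists_integer_shape_of_pointData {n : ℕ} {σ : Type*} (F : σ → MvPolynomial (Fin n) ℚ)
    (V : Finset (Fin n → ℂ)) (hV : ∀ z, z ∈ V ↔ ∀ j, MvPolynomial.aeval z (F j) = 0)
    {B : ℝ} (hB : 2 ≤ B) (b : (Fin n → ℂ) → Fin n → ℕ) (hb0 : ∀ z ∈ V, ∀ i, 0 < b z i)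
    (hbB : ∀ z ∈ V, ∀ i, (b z i : ℝ) ≤ B) (hbint : ∀ z ∈ V, ∀ i, IsIntegral ℤ ((b z i : ℂ) * z i))
    (hzB : ∀ z ∈ V, ∀ i, ‖z i‖ ≤ B) :
    ∃ (ℓ : Fin n → ℤ) (lam : ℕ) (v : Fin n → ℤ[X]), 0 < lam ∧
      (∀ z ∈ V, ∀ i, z i = (lam : ℂ)⁻¹ * aeval (∑ k, (ℓ k : ℂ) * z k) (v i)) ∧
      (∀ i, (v i).degree < V.card) ∧
      (lam : ℝ) ≤ B ^ (V.card * n) *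
        (2 * (n * V.card ^ 2 * B ^ (V.card * n + 1) + 1)) ^ (V.card * V.card) ∧
      ∀ i, (polyWeight (v i) : ℝ) ≤ V.card ^ 2 * B ^ (V.card * n + 1) *
        (2 * (n * V.card ^ 2 * B ^ (V.card * n + 1) + 1)) ^ (V.card * V.card) := by
  have hB0 : 0 ≤ B := by linarith
  have hB1 : 1 ≤ B := by linarith
  set N := V.card with hN
  -- the common denominator `c`
  set c : ℕ := ∏ z ∈ V, ∏ i, b z i with hc
  have hc0 : 0 < c := Finset.prod_pos fun z hz => Finset.prod_pos fun i _ => hb0 z hz i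
  have hcC : (c : ℂ) ≠ 0 := Nat.cast_ne_zero.2 hc0.ne'
  have hcB : (c : ℝ) ≤ B ^ (N * n) := by
    calc (c : ℝ) = ∏ z ∈ V, ∏ i, (b z i : ℝ) := by rw [hc]; push_cast; rfl
      _ ≤ ∏ z ∈ V, ∏ _i : Fin n, B :=
          prod_le_prod (fun _ _ => by positivity) fun z hz =>
            prod_le_prod (fun _ _ => by positivity) fun i _ => hbB z hz i
      _ = B ^ (N * n) := by
          rw [prod_const, prod_const, Finset.card_univ, Fintype.card_fin, ← pow_mul, mul_comm]
  have hcint : ∀ z ∈ V, ∀ i, IsIntegral ℤ ((c : ℂ) * z i) := by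
    intro z hz i
    have hdvd : b z i ∣ c :=
      (Finset.dvd_prod_of_mem (fun i => b z i) (mem_univ i)).trans
        (Finset.dvd_prod_of_mem (fun z => ∏ i, b z i) hz)
    obtain ⟨q, hq⟩ := hdvd
    have : (c : ℂ) * z i = algebraMap ℤ ℂ (q : ℤ) * ((b z i : ℂ) * z i) := by
      rw [hq, algebraMap_int_eq, eq_intCast]; push_cast; ring
    rw [this]
    exact isIntegral_algebraMap.mul (hbint z hz i)
  -- a separating form with small natural coefficients, scaled by `c`
  obtain ⟨ℓ₀, hℓ₀le, hℓ₀sep⟩ := exists_separating_linearForm (K := ℂ) V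
  set ℓ : Fin n → ℤ := fun i => (c : ℤ) * (ℓ₀ i : ℤ) with hℓ
  -- coordinates are algebraic over `ℚ`
  have hint : ∀ z ∈ V, ∀ i, IsIntegral ℚ (z i) := by
    intro z hz i
    have h1 : IsIntegral ℚ ((b z i : ℂ) * z i) := (hbint z hz i).tower_top
    have hb : (b z i : ℂ) ≠ 0 := Nat.cast_ne_zero.2 (hb0 z hz i).ne'
    have : z i = algebraMap ℚ ℂ ((b z i : ℚ)⁻¹) * ((b z i : ℂ) * z i) := by
      rw [map_inv₀, map_natCast, ← mul_assoc, inv_mul_cancel₀ hb, one_mul]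
    rw [this]
    exact isIntegral_algebraMap.mul h1
  -- the rational shape lemma
  have hfunℚ : ∀ z : Fin n → ℂ, (∑ i, algebraMap ℚ ℂ ((ℓ i : ℚ)) * z i) =
      (c : ℂ) * ∑ i, (ℓ₀ i : ℂ) * z i := by
    intro z
    rw [Finset.mul_sum]
    refine Finset.sum_congr rfl fun i _ => ?_
    simp only [hℓ, Int.cast_mul, Int.cast_natCast, map_mul, map_natCast]
    ring
  have hsepℚ : Set.InjOn (fun z : Fin n → ℂ => ∑ i, algebraMap ℚ ℂ ((ℓ i : ℚ)) * z i)
      (V : Set (Fin n → ℂ)) := by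
    intro z hz z' hz' h
    have h' : (c : ℂ) * ∑ i, (ℓ₀ i : ℂ) * z i = (c : ℂ) * ∑ i, (ℓ₀ i : ℂ) * z' i := by
      rwa [← hfunℚ, ← hfunℚ]
    exact hℓ₀sep hz hz' (mul_left_cancel₀ hcC h')
  obtain ⟨μℚ, hμmonic, -, -, hμprod, hv⟩ :=
    exists_rational_shape F V hV hint (fun i => (ℓ i : ℚ)) hsepℚ
  simp only [map_intCast] at hμprod hv
  set y : (Fin n → ℂ) → ℂ := fun z => ∑ k, (ℓ k : ℂ) * z k with hy
  have hyfun : ∀ z : Fin n → ℂ, y z = (c : ℂ) * ∑ i, (ℓ₀ i : ℂ) * z i := by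
    intro z
    rw [hy, Finset.mul_sum]
    refine Finset.sum_congr rfl fun i _ => ?_
    simp only [hℓ, Int.cast_mul, Int.cast_natCast]
    ring
  have hysep : Set.InjOn y (V : Set (Fin n → ℂ)) := by
    intro z hz z' hz' h
    rw [hyfun, hyfun] at h
    exact hℓ₀sep hz hz' (mul_left_cancel₀ hcC h)
  have hyint : ∀ z ∈ V, IsIntegral ℤ (y z) := by
    intro z hz
    have : y z = ∑ k, algebraMap ℤ ℂ (ℓ₀ k : ℤ) * ((c : ℂ) * z k) := by
      rw [hyfun, Finset.mul_sum]
      refine Finset.sum_congr rfl fun k _ => ?_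
      rw [algebraMap_int_eq, eq_intCast]; push_cast; ring
    rw [this]
    exact IsIntegral.sum _ fun k _ => isIntegral_algebraMap.mul (hcint z hz k)
  -- sizes
  set Y : ℝ := n * N ^ 2 * B ^ (N * n + 1) + 1 with hYdef
  have hY1 : 1 ≤ Y := by
    have h0 : (0 : ℝ) ≤ n * N ^ 2 * B ^ (N * n + 1) := by positivity
    rw [hYdef]; linarith
  have hyB : ∀ z ∈ V, ‖y z‖ ≤ Y := by
    intro z hz
    have hℓk : ∀ k, ‖(ℓ k : ℂ)‖ ≤ c * N ^ 2 := fun k => by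
      have e : ((ℓ k : ℤ) : ℂ) = (c : ℂ) * (ℓ₀ k : ℂ) := by simp [hℓ]
      rw [e, norm_mul, Complex.norm_natCast, Complex.norm_natCast]
      have h1 : ℓ₀ k ≤ N ^ 2 :=
        (hℓ₀le k).trans (by rw [sq]; exact Nat.mul_le_mul_left _ (Nat.sub_le _ _))
      have h2 : (ℓ₀ k : ℝ) ≤ (N : ℝ) ^ 2 := by exact_mod_cast h1
      exact mul_le_mul_of_nonneg_left h2 (Nat.cast_nonneg c)
    calc ‖y z‖ ≤ ∑ k, ‖(ℓ k : ℂ) * z k‖ := norm_sum_le _ _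
      _ ≤ ∑ _k : Fin n, (c * N ^ 2) * B := sum_le_sum fun k _ => by
          rw [norm_mul]; exact mul_le_mul (hℓk k) (hzB z hz k) (norm_nonneg _) (by positivity)
      _ = n * (c * N ^ 2 * B) := by rw [sum_const, Finset.card_univ, Fintype.card_fin]; simp [mul_assoc]
      _ ≤ n * (B ^ (N * n) * N ^ 2 * B) := by gcongr
      _ = n * N ^ 2 * B ^ (N * n + 1) := by ring
      _ ≤ Y := by rw [hYdef]; linarith
  -- the integer minimal polynomial and `D`
  obtain ⟨μ, D, -, -, -, hD0, hDC⟩ :=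
    exists_int_poly_eq_nodal V y hysep hyint μℚ hμmonic (by rw [hμprod]; rfl)
  -- the integer interpolants
  have hw : ∀ i, ∃ w : ℤ[X], w.degree < N ∧
      w.map (Int.castRingHom ℂ) =
        ∑ z ∈ V, C ((c : ℂ) * z i * ∏ z' ∈ V.erase z, (derivative (nodal V y)).eval (y z')) *
          nodal (V.erase z) y ∧
      ∀ z ∈ V, (c : ℂ) * D * z i = aeval (y z) w := by
    intro i
    obtain ⟨v, hvdeg, hvz⟩ := hv i
    exact exists_int_interpolant V y hysep hyint D hDC c (fun z => z i) (fun z hz => hcint z hz i)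
      v hvdeg hvz
  choose w hwdeg hwmap hwz using hw
  -- `λ = c |D|`, `v_i = sign(D) w_i`
  refine ⟨ℓ, c * D.natAbs, fun i => Polynomial.C D.sign * w i, ?_, ?_, ?_, ?_, ?_⟩
  · exact Nat.mul_pos hc0 (Int.natAbs_pos.2 hD0)
  · intro z hz i
    rw [map_mul, aeval_C, algebraMap_int_eq, eq_intCast, ← hwz i z hz]
    have hD : ((D.natAbs : ℕ) : ℂ) = (D.sign : ℂ) * D := by
      rw [← Int.cast_natCast, ← Int.sign_mul_self_eq_natAbs]; push_cast; ring
    have hne : ((c * D.natAbs : ℕ) : ℂ) ≠ 0 :=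
      Nat.cast_ne_zero.2 (Nat.mul_pos hc0 (Int.natAbs_pos.2 hD0)).ne'
    rw [eq_inv_mul_iff_mul_eq₀ hne]
    push_cast
    rw [hD]
    ring
  · intro i
    calc (Polynomial.C D.sign * w i).degree ≤ (w i).degree := by
          rw [← Polynomial.smul_eq_C_mul]; exact degree_smul_le _ _
      _ < N := hwdeg i
  · -- `λ ≤ B^{Nn} (2Y)^{N²}`
    have hDle : (D.natAbs : ℝ) ≤ (2 * Y) ^ (N * (N - 1)) := by
      have h1 : (D.natAbs : ℝ) = ‖(D : ℂ)‖ := by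
        rw [Complex.norm_intCast, Nat.cast_natAbs, Int.cast_abs]
      rw [h1, hDC]
      exact norm_prod_eval_derivative_nodal_le V y hyB
    have h2Y : (2 * Y) ^ (N * (N - 1)) ≤ (2 * Y) ^ (N * N) :=
      pow_le_pow_right₀ (by linarith) (Nat.mul_le_mul_left _ (Nat.sub_le _ _))
    push_cast
    exact mul_le_mul hcB (hDle.trans h2Y) (by positivity) (by positivity)
  · -- `wt(v_i) ≤ N² B^{Nn+1} (2Y)^{N²}`
    intro i
    rw [polyWeight_C_mul, Int.natAbs_sign_of_ne_zero hD0, one_mul]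
    have hT : ∀ z ∈ V, ‖(c : ℂ) * z i‖ ≤ B ^ (N * n + 1) := fun z hz => by
      rw [norm_mul, Complex.norm_natCast, pow_succ]
      exact mul_le_mul hcB (hzB z hz i) (norm_nonneg _) (by positivity)
    have hcoeff : ∀ k, (((w i).coeff k).natAbs : ℝ) ≤ N * B ^ (N * n + 1) * (2 * Y) ^ (N * (N - 1)) := by
      intro k
      have h1 : (((w i).coeff k).natAbs : ℝ) = ‖((w i).map (Int.castRingHom ℂ)).coeff k‖ := by
        rw [Polynomial.coeff_map, eq_intCast, Complex.norm_intCast, Nat.cast_natAbs, Int.cast_abs]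
      rw [h1, hwmap]
      exact norm_coeff_interpolant_le V y c (fun z => z i) (T := B ^ (N * n + 1)) hY1
        (by positivity) hyB hT k
    have h2Y : (2 * Y) ^ (N * (N - 1)) ≤ (2 * Y) ^ (N * N) :=
      pow_le_pow_right₀ (by linarith) (Nat.mul_le_mul_left _ (Nat.sub_le _ _))
    by_cases hw0 : w i = 0
    · rw [hw0, polyWeight_zero, Nat.cast_zero]; positivity
    have hdeg : (w i).natDegree < N := (natDegree_lt_iff_degree_lt hw0).2 (hwdeg i)
    rw [polyWeight_eq_sum_range _ hdeg, Nat.cast_sum]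
    calc ∑ k ∈ Finset.range N, (((w i).coeff k).natAbs : ℝ)
        ≤ ∑ _k ∈ Finset.range N, N * B ^ (N * n + 1) * (2 * Y) ^ (N * (N - 1)) :=
          sum_le_sum fun k _ => hcoeff k
      _ = N * (N * B ^ (N * n + 1) * (2 * Y) ^ (N * (N - 1))) := by
          rw [sum_const, Finset.card_range]; simp
      _ ≤ N * (N * B ^ (N * n + 1) * (2 * Y) ^ (N * N)) := by gcongr
      _ = N ^ 2 * B ^ (N * n + 1) * (2 * Y) ^ (N * N) := by ring

/-! ### Stage B: logarithmic bookkeeping -/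
set_option maxHeartbeats 400000 in -- buildfix (bf3-g27): 160k/180k FAIL, 200k PASS at accept time; line-neutral budget line
/-- The real-analysis bookkeeping turning the raw bounds of `exists_integer_shape_of_pointData`
(`N ≤ dⁿ` points, denominators and sizes `≤ e^H + 1`, `H = c₀ d^{c₀ n} log W`) into Bürgisser's
shape `c · d^{c n} · log W` with `c = 48 (c₀ + 4)`: if
`0 < X ≤ (N+1)² B^{Nn+1} (2Y)^{N²}`, `B = e^H + 1`, `Y = n N² B^{Nn+1} + 1`, `1 ≤ n < d`, `W ≥ 2`,
then `log X ≤ 48 (c₀+4) d^{48 (c₀+4) n} log W`. [folklore] -/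
theorem shape_log_bookkeeping {c₀ n d N W : ℕ} (hn : 1 ≤ n) (hnd : n < d) (hW : 2 ≤ W)
    (hN : N ≤ d ^ n) {X : ℝ} (hX0 : 0 < X)
    (hX : X ≤ ((N : ℝ) + 1) ^ 2 *
      (Real.exp (c₀ * (d : ℝ) ^ (c₀ * n) * Real.log W) + 1) ^ (N * n + 1) *
      (2 * (n * (N : ℝ) ^ 2 * (Real.exp (c₀ * (d : ℝ) ^ (c₀ * n) * Real.log W) + 1) ^ (N * n + 1)
        + 1)) ^ (N * N)) :
    Real.log X ≤ ((48 * (c₀ + 4) : ℕ) : ℝ) * (d : ℝ) ^ (48 * (c₀ + 4) * n) * Real.log W := by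
  -- abbreviations
  set H : ℝ := c₀ * (d : ℝ) ^ (c₀ * n) * Real.log W with hH
  set B : ℝ := Real.exp H + 1 with hB
  set Y : ℝ := n * (N : ℝ) ^ 2 * B ^ (N * n + 1) + 1 with hY
  have hd1 : (1 : ℝ) ≤ d := by exact_mod_cast (show 1 ≤ d by omega)
  have hlW : Real.log 2 ≤ Real.log W := Real.log_le_log two_pos (by exact_mod_cast hW)
  have hl2 : (1 : ℝ) / 2 < Real.log 2 := by have := Real.log_two_gt_d9; linarith
  have hl2' : Real.log 2 ≤ 1 := by have := Real.log_two_lt_d9; linarith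
  have hlW0 : 0 < Real.log W := by linarith
  have hH0 : 0 ≤ H := by rw [hH]; positivity
  have hB1 : 1 ≤ B := by rw [hB]; have := Real.exp_pos H; linarith
  have hB2 : B ≤ 2 * Real.exp H := by rw [hB]; have := Real.one_le_exp hH0; linarith
  have hBpow : 1 ≤ B ^ (N * n + 1) := one_le_pow₀ hB1
  have hY1 : 1 ≤ Y := by
    rw [hY]; have : (0 : ℝ) ≤ n * (N : ℝ) ^ 2 * B ^ (N * n + 1) := by positivity
    linarith
  have hNn : (0 : ℝ) ≤ N := Nat.cast_nonneg N
  have hnn : (0 : ℝ) ≤ n := Nat.cast_nonneg n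
  -- the logarithm of the bound
  have hlogM : Real.log (((N : ℝ) + 1) ^ 2 * B ^ (N * n + 1) * (2 * Y) ^ (N * N)) =
      2 * Real.log ((N : ℝ) + 1) + ((N * n + 1 : ℕ) : ℝ) * Real.log B +
        ((N * N : ℕ) : ℝ) * Real.log (2 * Y) := by
    rw [Real.log_mul (by positivity) (by positivity), Real.log_mul (by positivity) (by positivity),
      Real.log_pow, Real.log_pow, Real.log_pow]
    push_cast
    ring
  have h1 : Real.log ((N : ℝ) + 1) ≤ N := by
    have := Real.log_le_sub_one_of_pos (show (0 : ℝ) < N + 1 by positivity); linarith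
  have hn1 : Real.log ((n : ℝ) + 1) ≤ n := by
    have := Real.log_le_sub_one_of_pos (show (0 : ℝ) < n + 1 by positivity); linarith
  have h2 : Real.log B ≤ 1 + H := by
    calc Real.log B ≤ Real.log (2 * Real.exp H) := Real.log_le_log (by positivity) hB2
      _ = Real.log 2 + H := by rw [Real.log_mul two_ne_zero (Real.exp_pos H).ne', Real.log_exp]
      _ ≤ 1 + H := by linarith
  have h3 : Y ≤ ((n : ℝ) + 1) * ((N : ℝ) + 1) ^ 2 * B ^ (N * n + 1) := by
    have e : ((n : ℝ) + 1) * ((N : ℝ) + 1) ^ 2 * B ^ (N * n + 1) - Y =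
        ((N : ℝ) ^ 2 + 2 * n * N + 2 * N + n) * B ^ (N * n + 1) + (B ^ (N * n + 1) - 1) := by
      rw [hY]; ring
    have : 0 ≤ ((N : ℝ) ^ 2 + 2 * n * N + 2 * N + n) * B ^ (N * n + 1) + (B ^ (N * n + 1) - 1) := by
      have : 0 ≤ B ^ (N * n + 1) - 1 := by linarith
      positivity
    linarith
  have h4 : Real.log (2 * Y) ≤ 1 + n + 2 * N + ((N * n + 1 : ℕ) : ℝ) * (1 + H) := by
    calc Real.log (2 * Y) ≤ Real.log (2 * (((n : ℝ) + 1) * ((N : ℝ) + 1) ^ 2 * B ^ (N * n + 1))) :=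
          Real.log_le_log (by positivity) (by linarith)
      _ = Real.log 2 + Real.log ((n : ℝ) + 1) + 2 * Real.log ((N : ℝ) + 1) +
            ((N * n + 1 : ℕ) : ℝ) * Real.log B := by
          rw [Real.log_mul (by positivity) (by positivity), Real.log_mul (by positivity) (by positivity),
            Real.log_mul (by positivity) (by positivity), Real.log_pow, Real.log_pow]
          push_cast
          ring
      _ ≤ 1 + n + 2 * N + ((N * n + 1 : ℕ) : ℝ) * (1 + H) := by
          have := mul_le_mul_of_nonneg_left h2 (show (0 : ℝ) ≤ ((N * n + 1 : ℕ) : ℝ) by positivity)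
          linarith
  -- polynomial bookkeeping: `log M ≤ 6 (N+1)³ (n+1) (H+1)`
  have hlogM_le : Real.log (((N : ℝ) + 1) ^ 2 * B ^ (N * n + 1) * (2 * Y) ^ (N * N)) ≤
      6 * ((N : ℝ) + 1) ^ 3 * ((n : ℝ) + 1) * (H + 1) := by
    rw [hlogM]
    have hBterm := mul_le_mul_of_nonneg_left h2 (show (0 : ℝ) ≤ ((N * n + 1 : ℕ) : ℝ) by positivity)
    have hCterm := mul_le_mul_of_nonneg_left h4 (show (0 : ℝ) ≤ ((N * N : ℕ) : ℝ) by positivity)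
    have key : 2 * (N : ℝ) + ((N * n + 1 : ℕ) : ℝ) * (1 + H) +
        ((N * N : ℕ) : ℝ) * (1 + n + 2 * N + ((N * n + 1 : ℕ) : ℝ) * (1 + H)) ≤
        6 * ((N : ℝ) + 1) ^ 3 * ((n : ℝ) + 1) * (H + 1) := by
      push_cast
      set a : ℝ := (N : ℝ)
      set b : ℝ := (n : ℝ)
      set h : ℝ := H + 1 with hh
      have hh1 : 1 ≤ h := by rw [hh]; linarith
      have ha : 0 ≤ a := hNn
      have hb : 0 ≤ b := hnn
      -- terms without `h` are absorbed using `h ≥ 1`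
      have step1 : 2 * a + (a * b + 1) * h + a * a * (1 + b + 2 * a + (a * b + 1) * h) ≤
          (1 + 2 * a + 2 * a ^ 2 + 2 * a ^ 3 + a * b + a ^ 2 * b + a ^ 3 * b) * h := by
        have e : (1 + 2 * a + 2 * a ^ 2 + 2 * a ^ 3 + a * b + a ^ 2 * b + a ^ 3 * b) * h -
            (2 * a + (a * b + 1) * h + a * a * (1 + b + 2 * a + (a * b + 1) * h)) =
            (2 * a + a ^ 2 + a ^ 2 * b + 2 * a ^ 3) * (h - 1) := by ring
        have : 0 ≤ (2 * a + a ^ 2 + a ^ 2 * b + 2 * a ^ 3) * (h - 1) := by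
          have : 0 ≤ h - 1 := by linarith
          positivity
        linarith
      have step2 : (1 + 2 * a + 2 * a ^ 2 + 2 * a ^ 3 + a * b + a ^ 2 * b + a ^ 3 * b) * h ≤
          6 * (a + 1) ^ 3 * (b + 1) * h := by
        refine mul_le_mul_of_nonneg_right ?_ (by linarith)
        have e : 6 * (a + 1) ^ 3 * (b + 1) -
            (1 + 2 * a + 2 * a ^ 2 + 2 * a ^ 3 + a * b + a ^ 2 * b + a ^ 3 * b) =
            5 * a ^ 3 * b + 17 * a ^ 2 * b + 17 * a * b + 6 * b + 4 * a ^ 3 + 16 * a ^ 2 +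
              16 * a + 5 := by ring
        have : 0 ≤ 5 * a ^ 3 * b + 17 * a ^ 2 * b + 17 * a * b + 6 * b + 4 * a ^ 3 + 16 * a ^ 2 +
            16 * a + 5 := by positivity
        linarith
      have e1 : (1 : ℝ) + H = h := by rw [hh]; ring
      rw [e1]
      nlinarith [step1, step2]
    linarith
  -- sizes in terms of `d`
  have hN1 : (N : ℝ) + 1 ≤ 2 * (d : ℝ) ^ n := by
    have : (N : ℝ) ≤ (d : ℝ) ^ n := by exact_mod_cast hN
    have : (1 : ℝ) ≤ (d : ℝ) ^ n := one_le_pow₀ hd1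
    linarith
  have hN3 : ((N : ℝ) + 1) ^ 3 ≤ 8 * (d : ℝ) ^ (3 * n) := by
    calc ((N : ℝ) + 1) ^ 3 ≤ (2 * (d : ℝ) ^ n) ^ 3 := by gcongr
      _ = 8 * (d : ℝ) ^ (3 * n) := by rw [mul_pow, ← pow_mul, mul_comm n 3]; norm_num
  have hn1' : (n : ℝ) + 1 ≤ d := by exact_mod_cast Nat.succ_le_of_lt hnd
  have hH1 : H + 1 ≤ (c₀ + 2) * (d : ℝ) ^ (c₀ * n) * Real.log W := by
    have hdc : (1 : ℝ) ≤ (d : ℝ) ^ (c₀ * n) := one_le_pow₀ hd1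
    have h1 : Real.log W ≤ (d : ℝ) ^ (c₀ * n) * Real.log W := le_mul_of_one_le_left hlW0.le hdc
    have h2 : (1 : ℝ) ≤ 2 * ((d : ℝ) ^ (c₀ * n) * Real.log W) := by linarith
    have h3 : ((c₀ : ℝ) + 2) * (d : ℝ) ^ (c₀ * n) * Real.log W =
        H + 2 * ((d : ℝ) ^ (c₀ * n) * Real.log W) := by rw [hH]; ring
    rw [h3]; linarith
  have hexpn : 3 * n + 1 + c₀ * n ≤ 48 * (c₀ + 4) * n :=
    calc 3 * n + 1 + c₀ * n ≤ 3 * n + n + c₀ * n := by omega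
      _ = (c₀ + 4) * n := by ring
      _ ≤ 48 * ((c₀ + 4) * n) := Nat.le_mul_of_pos_left _ (by norm_num)
      _ = 48 * (c₀ + 4) * n := by ring
  have hexp : (d : ℝ) ^ (3 * n) * d * (d : ℝ) ^ (c₀ * n) ≤ (d : ℝ) ^ (48 * (c₀ + 4) * n) := by
    rw [← pow_succ, ← pow_add]
    exact pow_le_pow_right₀ hd1 hexpn
  calc Real.log X ≤ Real.log (((N : ℝ) + 1) ^ 2 * B ^ (N * n + 1) * (2 * Y) ^ (N * N)) :=
        Real.log_le_log hX0 hX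
    _ ≤ 6 * ((N : ℝ) + 1) ^ 3 * ((n : ℝ) + 1) * (H + 1) := hlogM_le
    _ ≤ 6 * (8 * (d : ℝ) ^ (3 * n)) * d * ((c₀ + 2) * (d : ℝ) ^ (c₀ * n) * Real.log W) := by
        gcongr
    _ = (48 * (c₀ + 2)) * ((d : ℝ) ^ (3 * n) * d * (d : ℝ) ^ (c₀ * n)) * Real.log W := by ring
    _ ≤ (48 * (c₀ + 4)) * (d : ℝ) ^ (48 * (c₀ + 4) * n) * Real.log W := by
        gcongr
        · linarith
    _ = ((48 * (c₀ + 4) : ℕ) : ℝ) * (d : ℝ) ^ (48 * (c₀ + 4) * n) * Real.log W := by push_cast; ring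

/-! ### Stage C: Bürgisser's ingredient (B) from zero-dimensional Bézout and point heights -/

/-- Cauchy's bound for an integer polynomial: a complex root `z` of `P ≠ 0` has
`|z| ≤ wt(P) + 1`. [folklore] -/
theorem norm_le_polyWeight_add_one_of_aeval_eq_zero {P : ℤ[X]} (hP : P ≠ 0) {z : ℂ}
    (hz : aeval z P = 0) : ‖z‖ ≤ polyWeight P + 1 := by
  set p := P.map (Int.castRingHom ℂ) with hp
  have hp0 : p ≠ 0 := (Polynomial.map_ne_zero_iff (RingHom.injective_int _)).2 hP
  have hroot : p.IsRoot z := by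
    rw [IsRoot.def, hp, eval_map, ← algebraMap_int_eq, ← aeval_def, hz]
  have h1 := hroot.norm_lt_cauchyBound hp0
  have hcoeff : ∀ k, ‖p.coeff k‖₊ ≤ (polyWeight P : NNReal) := by
    intro k
    have h' : (((P.coeff k).natAbs : ℕ) : ℝ) ≤ polyWeight P := by
      exact_mod_cast natAbs_coeff_le_polyWeight P k
    rw [Nat.cast_natAbs, Int.cast_abs] at h'
    have : ‖p.coeff k‖ ≤ polyWeight P := by
      rwa [hp, Polynomial.coeff_map, eq_intCast, Complex.norm_intCast]
    exact_mod_cast this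
  have hlead : 1 ≤ ‖p.leadingCoeff‖₊ := by
    have hl : p.leadingCoeff = (P.leadingCoeff : ℂ) := by
      rw [hp, leadingCoeff_map_of_injective (RingHom.injective_int _), eq_intCast]
    have hne : P.leadingCoeff ≠ 0 := leadingCoeff_ne_zero.2 hP
    have : (1 : ℝ) ≤ ‖p.leadingCoeff‖ := by
      rw [hl, Complex.norm_intCast]
      exact_mod_cast Int.one_le_abs hne
    exact_mod_cast this
  have hcb : cauchyBound p ≤ (polyWeight P : NNReal) + 1 := by
    unfold cauchyBound
    gcongr
    calc (Finset.range p.natDegree).sup (fun k => ‖p.coeff k‖₊) / ‖p.leadingCoeff‖₊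
        ≤ (Finset.range p.natDegree).sup (fun k => ‖p.coeff k‖₊) := div_le_self (by simp) hlead
      _ ≤ polyWeight P := Finset.sup_le fun k _ => hcoeff k
  have : (‖z‖₊ : ℝ) ≤ ((polyWeight P : NNReal) + 1 : NNReal) := by exact_mod_cast (h1.le.trans hcb)
  simpa using this

/-- **Bürgisser's ingredient (B) of Theorem 4.5 from zero-dimensional Bézout and the heights of
the points.** The hypothesis `hB` of `algebraicSolution_height_bound_of_ingredients` — Krick–Pardo
[18, Prop. 27] combined with Lemma 2.4 as on p. 82 of Bürgisser 2000 TCS: for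
`F_1, …, F_n ∈ ℤ[X_1, …, X_n]` of degree `≤ d`, `n < d`, weight `≤ W`, `W ≥ 2`, with finite complex
zero set `V`, "the existence of an integer linear form `ℓ`, of a positive integer `λ`, and of
univariate integer polynomials `v_i ∈ ℤ[Y]` such that … `x_i = λ⁻¹ v_i(ℓ(x))` for all `x ∈ V`",
with `deg v_i ≤ c d^{cn}` and `max{log λ, log wt(v_i)} ≤ c d^{cn} log W` — follows from two
statements about the POINTS of `V`:
* `hBez` — zero-dimensional Bézout: `|V| ≤ dⁿ` (Bézout's inequality, [7, 8.28] of the paper);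
* `hHt` — every coordinate of every point of `V` is a root of a nonzero integer polynomial of
  weight `≤ W^{c₀ d^{c₀ n}}` (the arithmetic Bézout theorem for the isolated points, e.g.
  Krick–Pardo–Sombra 2001; in the paper this is implicit in [18, Prop. 27 (4)] + Lemma 2.4).
Proof: separating form with coefficients `≤ N²` scaled by the common denominator
`c = ∏ |lc|` (`SeparatingForm.lean`), rational shape lemma (`RationalShapeLemma.lean`), integral
minimal polynomial, `D = Res(μ, μ')` and integral Lagrange–Euler interpolants
(`IntegralShapeLemma.lean`), archimedean bounds (`IntegralShapeLemmaBounds.lean`), Cauchy's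
root bound, and the bookkeeping `shape_log_bookkeeping`; `c = 48 (c₀ + 4)`.
[cite: Burgisser2000TCS, proof of Thm. 4.5 p. 82] -/
theorem krickPardo_shape_of_bezout_of_pointHeights
    (hBez : ∀ (n d : ℕ) (F : Fin n → MvPolynomial (Fin n) ℤ), (∀ i, (F i).totalDegree ≤ d) →
      {z : Fin n → ℂ | ∀ i, MvPolynomial.aeval z (F i) = 0}.Finite →
      {z : Fin n → ℂ | ∀ i, MvPolynomial.aeval z (F i) = 0}.ncard ≤ d ^ n)
    (hHt : ∃ c₀ : ℕ, ∀ (n d W : ℕ) (F : Fin n → MvPolynomial (Fin n) ℤ), n < d → 2 ≤ W →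
      (∀ i, (F i).totalDegree ≤ d) → (∀ i, weight (F i) ≤ W) →
      {z : Fin n → ℂ | ∀ i, MvPolynomial.aeval z (F i) = 0}.Finite →
      ∀ z : Fin n → ℂ, (∀ i, MvPolynomial.aeval z (F i) = 0) → ∀ j, ∃ P : ℤ[X], P ≠ 0 ∧
        aeval (z j) P = 0 ∧ Real.log (polyWeight P) ≤ c₀ * (d : ℝ) ^ (c₀ * n) * Real.log W) :
    ∃ c : ℕ, ∀ (n d W : ℕ) (F : Fin n → MvPolynomial (Fin n) ℤ),
      n < d → 2 ≤ W → (∀ i, (F i).totalDegree ≤ d) → (∀ i, weight (F i) ≤ W) →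
      {z : Fin n → ℂ | ∀ i, MvPolynomial.aeval z (F i) = 0}.Finite →
      ∃ (ℓ : Fin n → ℤ) (lam : ℕ) (v : Fin n → Polynomial ℤ), 0 < lam ∧
        (∀ z : Fin n → ℂ, (∀ i, MvPolynomial.aeval z (F i) = 0) →
          ∀ j, z j = (lam : ℂ)⁻¹ * Polynomial.aeval (∑ k, (ℓ k : ℂ) * z k) (v j)) ∧
        (∀ j, (v j).natDegree ≤ c * d ^ (c * n)) ∧
        Real.log lam ≤ c * (d : ℝ) ^ (c * n) * Real.log W ∧
        ∀ j, Real.log (polyWeight (v j)) ≤ c * (d : ℝ) ^ (c * n) * Real.log W := by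
  obtain ⟨c₀, hHt⟩ := hHt
  refine ⟨48 * (c₀ + 4), ?_⟩
  intro n d W F hnd hW hdeg hwt hfin
  have hd1 : 1 ≤ d := by omega
  have hRHS : 0 ≤ ((48 * (c₀ + 4) : ℕ) : ℝ) * (d : ℝ) ^ (48 * (c₀ + 4) * n) * Real.log W := by
    have : 0 ≤ Real.log W := Real.log_natCast_nonneg W
    positivity
  -- the degenerate case `n = 0`
  rcases Nat.eq_zero_or_pos n with hn0 | hn
  · subst hn0
    refine ⟨Fin.elim0, 1, Fin.elim0, Nat.one_pos, fun z _ j => j.elim0, fun j => j.elim0, ?_,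
      fun j => j.elim0⟩
    simpa using hRHS
  -- the points and their data
  set V := hfin.toFinset with hVdef
  have hVmem : ∀ z, z ∈ V ↔ ∀ i, MvPolynomial.aeval z (F i) = 0 := fun z => by
    rw [hVdef, Set.Finite.mem_toFinset]; rfl
  have hN : V.card ≤ d ^ n := by
    rw [hVdef, ← Set.ncard_eq_toFinset_card _ hfin]
    exact hBez n d F hdeg hfin
  set H : ℝ := c₀ * (d : ℝ) ^ (c₀ * n) * Real.log W with hH
  have hP : ∀ z, ∃ P : Fin n → ℤ[X], z ∈ V → ∀ j, P j ≠ 0 ∧ aeval (z j) (P j) = 0 ∧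
      Real.log (polyWeight (P j)) ≤ H := by
    intro z
    by_cases hz : z ∈ V
    · have := fun j => hHt n d W F hnd hW hdeg hwt hfin z ((hVmem z).1 hz) j
      choose P hP0 hProot hPH using this
      exact ⟨P, fun _ j => ⟨hP0 j, hProot j, hPH j⟩⟩
    · exact ⟨fun _ => 1, fun h => (hz h).elim⟩
  choose P hP using hP
  set B : ℝ := Real.exp H + 1 with hBdef
  have hB2 : 2 ≤ B := by rw [hBdef]; have := Real.one_le_exp (by rw [hH]; positivity : (0:ℝ) ≤ H); linarith
  have hwtB : ∀ z ∈ V, ∀ j, (polyWeight (P z j) : ℝ) ≤ Real.exp H := by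
    intro z hz j
    obtain ⟨hP0, -, hPH⟩ := hP z hz j
    have hpos : (0 : ℝ) < polyWeight (P z j) := by
      have : (P z j).leadingCoeff.natAbs ≤ polyWeight (P z j) := natAbs_coeff_le_polyWeight _ _
      have : 0 < (P z j).leadingCoeff.natAbs := Int.natAbs_pos.2 (leadingCoeff_ne_zero.2 hP0)
      exact_mod_cast (by omega : 0 < polyWeight (P z j))
    exact (Real.log_le_iff_le_exp hpos).1 hPH
  set b : (Fin n → ℂ) → Fin n → ℕ := fun z j => (P z j).leadingCoeff.natAbs with hbdef
  have hb0 : ∀ z ∈ V, ∀ j, 0 < b z j := fun z hz j =>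
    Int.natAbs_pos.2 (leadingCoeff_ne_zero.2 (hP z hz j).1)
  have hbB : ∀ z ∈ V, ∀ j, (b z j : ℝ) ≤ B := by
    intro z hz j
    calc (b z j : ℝ) ≤ polyWeight (P z j) := by exact_mod_cast natAbs_coeff_le_polyWeight _ _
      _ ≤ Real.exp H := hwtB z hz j
      _ ≤ B := by rw [hBdef]; linarith
  have hbint : ∀ z ∈ V, ∀ j, IsIntegral ℤ ((b z j : ℂ) * z j) := by
    intro z hz j
    have h1 : IsIntegral ℤ ((P z j).leadingCoeff • z j) := isIntegral_leadingCoeff_smul _ _ (hP z hz j).2.1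
    have h2 : ((b z j : ℕ) : ℂ) * z j =
        algebraMap ℤ ℂ (P z j).leadingCoeff.sign * ((P z j).leadingCoeff • z j) := by
      rw [zsmul_eq_mul, ← mul_assoc, algebraMap_int_eq, eq_intCast, ← Int.cast_mul,
        Int.sign_mul_self_eq_natAbs, Int.cast_natCast]
    rw [h2]
    exact isIntegral_algebraMap.mul h1
  have hzB : ∀ z ∈ V, ∀ j, ‖z j‖ ≤ B := by
    intro z hz j
    calc ‖z j‖ ≤ polyWeight (P z j) + 1 :=
          norm_le_polyWeight_add_one_of_aeval_eq_zero (hP z hz j).1 (hP z hz j).2.1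
      _ ≤ B := by rw [hBdef]; linarith [hwtB z hz j]
  -- Stage A over `ℚ`
  set Fℚ : Fin n → MvPolynomial (Fin n) ℚ := fun i => MvPolynomial.map (Int.castRingHom ℚ) (F i)
  have hVℚ : ∀ z, z ∈ V ↔ ∀ i, MvPolynomial.aeval z (Fℚ i) = 0 := by
    intro z
    rw [hVmem]
    refine forall_congr' fun i => ?_
    change _ ↔ MvPolynomial.aeval z (MvPolynomial.map (Int.castRingHom ℚ) (F i)) = 0
    rw [← algebraMap_int_eq, MvPolynomial.aeval_map_algebraMap]
  obtain ⟨ℓ, lam, v, hlam, hshape, hvdeg, hlamB, hvB⟩ :=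
    exists_integer_shape_of_pointData Fℚ V hVℚ hB2 b hb0 hbB hbint hzB
  have hlamB' := hlamB
  refine ⟨ℓ, lam, v, hlam, fun z hz j => hshape z ((hVmem z).2 hz) j, fun j => ?_, ?_, fun j => ?_⟩
  · -- degrees
    have h1 : (v j).natDegree ≤ V.card := by
      by_cases hv0 : v j = 0
      · rw [hv0, natDegree_zero]; exact Nat.zero_le _
      · exact ((natDegree_lt_iff_degree_lt hv0).2 (hvdeg j)).le
    calc (v j).natDegree ≤ d ^ n := h1.trans hN
      _ ≤ 1 * d ^ (48 * (c₀ + 4) * n) := by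
          rw [one_mul]; exact Nat.pow_le_pow_right hd1 (Nat.le_mul_of_pos_left _ (by omega))
      _ ≤ 48 * (c₀ + 4) * d ^ (48 * (c₀ + 4) * n) := Nat.mul_le_mul_right _ (by omega)
  · -- `log λ`
    refine shape_log_bookkeeping (c₀ := c₀) hn hnd hW hN (by exact_mod_cast hlam) ?_
    refine hlamB.trans ?_
    have hB1 : 1 ≤ B := by linarith
    have hY0 : 0 ≤ 2 * (n * (V.card : ℝ) ^ 2 * B ^ (V.card * n + 1) + 1) := by positivity
    calc B ^ (V.card * n) * (2 * (n * (V.card : ℝ) ^ 2 * B ^ (V.card * n + 1) + 1)) ^ (V.card * V.card)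
        ≤ (1 * B ^ (V.card * n + 1)) *
            (2 * (n * (V.card : ℝ) ^ 2 * B ^ (V.card * n + 1) + 1)) ^ (V.card * V.card) := by
          gcongr
          rw [one_mul]
          exact pow_le_pow_right₀ hB1 (Nat.le_succ _)
      _ ≤ (((V.card : ℝ) + 1) ^ 2 * B ^ (V.card * n + 1)) *
            (2 * (n * (V.card : ℝ) ^ 2 * B ^ (V.card * n + 1) + 1)) ^ (V.card * V.card) := by
          gcongr
          nlinarith [sq_nonneg (V.card : ℝ), (Nat.cast_nonneg V.card : (0:ℝ) ≤ V.card)]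
  · -- `log wt(v_j)`
    by_cases hv0 : polyWeight (v j) = 0
    · rw [hv0, Nat.cast_zero, Real.log_zero]; exact hRHS
    refine shape_log_bookkeeping (c₀ := c₀) hn hnd hW hN
      (by exact_mod_cast Nat.pos_of_ne_zero hv0) ?_
    refine (hvB j).trans ?_
    gcongr
    nlinarith [sq_nonneg (V.card : ℝ), (Nat.cast_nonneg V.card : (0:ℝ) ≤ V.card)]

/-- **Theorem 4.5 from three point-level statements.** Bürgisser's named fact
`algebraicSolution_height_bound` (TCS 2000, Thm. 4.5) follows from (A) the zero-dimensional
reduction with small weight (Lemmas 4.3–4.4, hypothesis `hA` of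
`algebraicSolution_height_bound_of_ingredients`), zero-dimensional Bézout `hBez` and the point
heights `hHt` (see `krickPardo_shape_of_bezout_of_pointHeights`).
[cite: Burgisser2000TCS, Thm. 4.5 and its proof p. 82] -/
theorem algebraicSolution_height_bound_of_zeroDimReduction_of_bezout_of_pointHeights
    (hA : ∀ (n s d w : ℕ) (S : Fin s → MvPolynomial (Fin n) ℤ),
      n < d → 1 ≤ w → (∀ i, (S i).totalDegree ≤ d) → (∀ i, weight (S i) ≤ w) →
      (∃ z : Fin n → ℂ, ∀ i, MvPolynomial.aeval z (S i) = 0) →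
      ∃ F : Fin n → MvPolynomial (Fin n) ℤ,
        (∀ i, (F i).totalDegree ≤ d) ∧ (∀ i, weight (F i) ≤ w * d ^ (2 * n)) ∧
        {z : Fin n → ℂ | ∀ i, MvPolynomial.aeval z (F i) = 0}.Finite ∧
        ∃ z : Fin n → ℂ, (∀ i, MvPolynomial.aeval z (F i) = 0) ∧
          ∀ i, MvPolynomial.aeval z (S i) = 0)
    (hBez : ∀ (n d : ℕ) (F : Fin n → MvPolynomial (Fin n) ℤ), (∀ i, (F i).totalDegree ≤ d) →
      {z : Fin n → ℂ | ∀ i, MvPolynomial.aeval z (F i) = 0}.Finite →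
      {z : Fin n → ℂ | ∀ i, MvPolynomial.aeval z (F i) = 0}.ncard ≤ d ^ n)
    (hHt : ∃ c₀ : ℕ, ∀ (n d W : ℕ) (F : Fin n → MvPolynomial (Fin n) ℤ), n < d → 2 ≤ W →
      (∀ i, (F i).totalDegree ≤ d) → (∀ i, weight (F i) ≤ W) →
      {z : Fin n → ℂ | ∀ i, MvPolynomial.aeval z (F i) = 0}.Finite →
      ∀ z : Fin n → ℂ, (∀ i, MvPolynomial.aeval z (F i) = 0) → ∀ j, ∃ P : ℤ[X], P ≠ 0 ∧
        aeval (z j) P = 0 ∧ Real.log (polyWeight P) ≤ c₀ * (d : ℝ) ^ (c₀ * n) * Real.log W) :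
    algebraicSolution_height_bound :=
  algebraicSolution_height_bound_of_ingredients hA (krickPardo_shape_of_bezout_of_pointHeights hBez hHt)

/-- **The target fact from three point-level statements.** Bürgisser's Cor. 1.2(1) for
`P/poly = NP/poly` (the named fact `PPoly_eq_polyAdvice_NP_of_VP_eq_VNP k`): with the GRH input,
Cor. 4.8, Thm. 4.1 and (A3) proved in the tree (`PPoly_eq_polyAdvice_NP_of_VP_eq_VNP_of_heightBound`),
it follows from (A), zero-dimensional Bézout and the point heights.
[cite: Burgisser2000TCS, Cor. 1.2(1) p. 74 and Thm. 4.5 p. 82] -/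
theorem PPoly_eq_polyAdvice_NP_of_VP_eq_VNP_of_zeroDimReduction_of_bezout_of_pointHeights
    (k : Type) [Field k]
    (hA : ∀ (n s d w : ℕ) (S : Fin s → MvPolynomial (Fin n) ℤ),
      n < d → 1 ≤ w → (∀ i, (S i).totalDegree ≤ d) → (∀ i, weight (S i) ≤ w) →
      (∃ z : Fin n → ℂ, ∀ i, MvPolynomial.aeval z (S i) = 0) →
      ∃ F : Fin n → MvPolynomial (Fin n) ℤ,
        (∀ i, (F i).totalDegree ≤ d) ∧ (∀ i, weight (F i) ≤ w * d ^ (2 * n)) ∧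
        {z : Fin n → ℂ | ∀ i, MvPolynomial.aeval z (F i) = 0}.Finite ∧
        ∃ z : Fin n → ℂ, (∀ i, MvPolynomial.aeval z (F i) = 0) ∧
          ∀ i, MvPolynomial.aeval z (S i) = 0)
    (hBez : ∀ (n d : ℕ) (F : Fin n → MvPolynomial (Fin n) ℤ), (∀ i, (F i).totalDegree ≤ d) →
      {z : Fin n → ℂ | ∀ i, MvPolynomial.aeval z (F i) = 0}.Finite →
      {z : Fin n → ℂ | ∀ i, MvPolynomial.aeval z (F i) = 0}.ncard ≤ d ^ n)
    (hHt : ∃ c₀ : ℕ, ∀ (n d W : ℕ) (F : Fin n → MvPolynomial (Fin n) ℤ), n < d → 2 ≤ W →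
      (∀ i, (F i).totalDegree ≤ d) → (∀ i, weight (F i) ≤ W) →
      {z : Fin n → ℂ | ∀ i, MvPolynomial.aeval z (F i) = 0}.Finite →
      ∀ z : Fin n → ℂ, (∀ i, MvPolynomial.aeval z (F i) = 0) → ∀ j, ∃ P : ℤ[X], P ≠ 0 ∧
        aeval (z j) P = 0 ∧ Real.log (polyWeight P) ≤ c₀ * (d : ℝ) ^ (c₀ * n) * Real.log W) :
    PPoly_eq_polyAdvice_NP_of_VP_eq_VNP k :=
  PPoly_eq_polyAdvice_NP_of_VP_eq_VNP_of_heightBound k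
    (algebraicSolution_height_bound_of_zeroDimReduction_of_bezout_of_pointHeights hA hBez hHt)

end Literature.Computability.AlgebraicComplexity

end
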